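import Summits.BirchSwinnertonDyer.BirchSwinnertonDyer.Theorems.ResidualThetaTransportAtTwoSignedMuVanishingAtTwoPlusSel2
import Summits.BirchSwinnertonDyer.BirchSwinnertonDyer.Theorems.ResidualThetaTransportAtTwoSignedMuSeedAtTwoPlusSplitFiniteness
import Summits.BirchSwinnertonDyer.BirchSwinnertonDyer.Cruxes.SignedMuSeedAtTwoPlus.Lines.index_identity_descent
import Summits.BirchSwinnertonDyer.BirchSwinnertonDyer.Cruxes.SignedMuSeedAtTwoPlus.Lines.kolyvagin_char_two
import Literature.NumberTheory.EllipticCurves.Kato2004.EulerSystemBoundFineSelmerTwo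
import Literature.NumberTheory.EllipticCurves.Kato2004.IwasawaCohomologyExistsProofs
import Literature.NumberTheory.EllipticCurves.TateModuleContinuityProofs
import Literature.NumberTheory.EllipticCurves.TateModuleFreeProofs
import HarnessLib

/-!
# Line `zeta-congruence` for crux `SignedMuSeedAtTwoPlus` (stmt-BirchSwinnertonDyer-21438) — crux-ideate r1 k2 (g33)

PROPOSAL SKELETON (W-79: NOT registered with `ledger skeleton check`; the seed line of record stays
`Lines/kolyvagin_char_two.lean`, the Kμ⁺ line of record `Cruxes/SignedMuVanishingAtTwoPlus/Lines/birth.lean` v4.2).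
Card: `Ideas/zeta-congruence.md`; line card: `Lines/zeta-congruence.md`.  BSD is NOT proved; 21438 is OPEN.

THE LINE (k2 = Euler-system / GL₂-Hecke-algebra technique; `A := W`, `e := refl`).  Write `ρ̄ = W[2]` (image
`S₃ = SL₂(𝔽₂)`), `K = ℚ(√Δ_W)` (2 inert), `χ̄ : G_K → 𝔽₄ˣ` with `ρ̄ ≅ Ind χ̄`, `g = θ_ψ` the CM theta partner
(`HeckeThetaPartnerAdicAtTwo`, stmt-20690: `ψ̄_𝔓 = χ̄`), `𝔪 ∋ 2` the common non-Eisenstein maximal Hecke ideal.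
Everything happens in GLOBAL Iwasawa cohomology MODULO 2, where `H¹(ℤ[1/S], ρ̄ ⊗ 𝔽₂⟦Γ⟧)` is torsion-free over
the DVR `Ω = 𝔽₂⟦T⟧` (`ρ̄^{G_ℚ} = 0`), so "`≠ 0 mod 2`" is transported by any non-zero scalar:

* Z1 (`FlatDetectsKatoZetaClassModTwo`, = kcz S3 sharpened to Kato's own `(c,d,a(A))`-zeta family `ZetaBody`):
  FLAT(W) (sibling crux 21437, scalar form `v₂(ϖ) + μ(L⁻) = 0`) ⇒ the Λ-adic lift `y_W` of Kato's zeta family is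
  not divisible by `2` in `𝐇¹_Γ(T₂W)` [Otsuki 2009 integral Coleman maps over `ℚ₂` at `p = 2`; in print].
* ZD (`KatoZetaClassDominatesRhoUnitsAtTwo`, THE LEVER, informally Z2 ∘ Z3 ∘ Z4 ∘ nonsquare-descent):
  Z2 ZETA-CONGRUENCE MOD 2 — Kato's construction is Hecke-linear, so the `𝕋_𝔪`-adic zeta element of
  `H¹(X₀(N), ℤ₂)_𝔪` (free of rank 2 by Buzzard's mod-2 multiplicity one, tree fact
  `buzzard2000_multiplicityOne_gamma0`, `N = lcm(N_W, N_g)` odd) specialises to the Σ-imprimitive zeta elements of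
  BOTH `W` and `g`; mod `𝔪` they are the same class (Kim–Lee–Ponsinet arXiv:1909.01764 §4.3/Thm "congruences of
  Kato elements", p odd — port: FL-range used there only for mult-one and Ihara; at 2: Buzzard + weight-2 Ihara,
  Assumption 1.2 `SL₂(𝔽₂) = S₃` automatic), Σ/`(c,d)` Euler factors are non-zero in `Ω` ⇒ `ȳ_W ≠ 0 ⇔ ȳ_g ≠ 0`;
  Z3 KATO–CM DOMINATION — `y_g ∈ Λ_𝒪 · ζ_ψ^{tw}` integrally in `𝐇¹(K, T_𝔓 g) = 𝐇¹(ℚ, T_𝔓 g)` (`T_𝔓 g|_{G_K}`-line of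
  `ψ_𝔓`; Kato 2004 §15 gives the comparison in `𝐇¹ ⊗ ℚ` by rank one + equal `exp*`-values; integrality of the ONE
  constant = a period-lattice statement at 2 of the type of `cm-manin-period` E4) ⇒ `ζ̄_ψ ≠ 0`;
  Z4 RESIDUAL LINE IDENTITY — the `ψ_𝔓`-cyclotomic and the `χ`-cyclotomic specialisations
  `𝒪⟦Gal(K(𝔣2^∞)/K)⟧ → 𝒪(φ) ⊗ Λ_cyc` agree modulo 2 because `ψ̄_𝔓 = χ̄` (and `ε̄ = 1`), hence the two cyclotomic
  elliptic-unit classes have the SAME reduction in `H¹(K, 𝔽₄(χ̄) ⊗ Ω) = lim_n (𝒪_{M_n,S}^×/2 ⊗ 𝔽₄)^χ` ⇒ `ζ̄_χ ≠ 0`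
  ⇒ some layer's χ-elliptic unit is a global non-square (GNS) ⇒ `μ((Ē/C̄)^χ) = 0` ⇒ the ρ̄-isotypic unit-index
  exponent is linearly bounded (the conclusion VERBATIM `IndexIdentityDescent.RhoUnitIndexBoundedOnHabitat`).
* then VERBATIM the `index_identity_descent` glue: Oukhaba's index identity (T1, in print all p) + T2/T5 ⇒ (F);
  (P⁺) shared (`PlusHalfOnHabitat`); Lim 2017 at two + `FineSplit.splitFiniteness` (p596845) + Sel2 door (p580570).
No Kolyvagin-system argument anywhere (kcz S2 / Mazur–Rubin (H.4) at `p = 2` is BYPASSED), no explicit reciprocity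
law in the Lubin–Tate tower at inert 2 (theta_symbol_seed S3a-i BYPASSED), no second cusp-span certificate.
-/

open scoped NumberField TensorProduct MatrixGroups ModularForm
open Field IsDedekindDomain CongruenceSubgroup
open WeierstrassCurve Literature.NumberTheory.EllipticCurves
open Literature.NumberTheory.GaloisRepresentations
open Literature.NumberTheory.EllipticCurves.Kato2004 Literature.NumberTheory.EllipticCurves.Kato2004.EulerSystemValues
open Literature.NumberTheory.EllipticCurves.Kobayashi2003
open Literature.NumberTheory.EllipticCurves.Rank1Residual
open Literature.NumberTheory.EllipticCurves.ModularForms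
open Literature.NumberTheory.IwasawaTheory
open Literature.NumberTheory.ComplexMultiplication.EllipticUnits
open Literature.NumberTheory.NumberFields (rayClassField)
open Summit.BirchSwinnertonDyer.Rank1Residual.Supersingular Summit.BirchSwinnertonDyer.Rank1Residual.X1
open Summit.BirchSwinnertonDyer.BirchSwinnertonDyer.Theses.ResidualThetaTransportAtTwo
open Summit.BirchSwinnertonDyer.BirchSwinnertonDyer.Cruxes.SignedMuSeedAtTwoPlus

set_option autoImplicit false
-- the Cruxes namespace of this sub repeats the summit name by design (D-0017 nested layout)
set_option linter.dupNamespace false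

noncomputable section

namespace Summit.BirchSwinnertonDyer.BirchSwinnertonDyer.Cruxes.SignedMuSeedAtTwoPlus.ZetaCongruence

/-! ## Vocabulary (tree objects only) -/

/-- `y ∈ 𝐇¹_Γ(T₂W)` (the pinned `IwasawaH1Data` along a cyclotomic `κ`) IS the Λ-adic lift of Kato's
`(c, d, a(A))`-zeta family of the weight-2 form `f` — a `ZetaBody W 2 f …` witness (Kato (8.1.3)/Ex. 13.3 with its
value law, tree `Kato2004.ZetaBody`) whose `2`-power levels, corestricted to the layers `ℚ_n`, are the projections
of `y` (tree `IwasawaH1Data.existsUnique_lift_of_zetaBody_two`).  This pins "Kato's class", as opposed to an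
arbitrary integral Euler-system class (`IsEulerSystemClassTwo`), which is what the `𝕋_𝔪`-adic interpolation needs. -/
def IsKatoZetaLift (W : WeierstrassCurve ℚ) [W.IsElliptic] [ContinuousSMul ℤ_[2] (W.tateModule 2)]
    [Module.Free ℤ_[2] (W.tateModule 2)] [Module.Finite ℤ_[2] (W.tateModule 2)]
    {κ : ZpExtension ℚ 2} {γ : Field.absoluteGaloisGroup ℚ} (hκ : κ.IsCyclotomic)
    (I : Kato2004.IwasawaH1Data W 2 κ γ) {N : ℕ} (f : CuspForm (Gamma0 N) 2) (y : I.H) : Prop :=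
  ∃ (ι : (m : ℕ) → (CyclotomicField m ℚ →+* ℂ)) (κ' : ℝ)
    (Λ' : ∀ (k : ℕ) (r : Finset (HeightOneSpectrum (𝓞 ℚ))),
      H1 (tateRep W 2) (cycSubgroup 2 k r) →ₗ[ℤ_[2]] ℚ_[2] ⊗[ℚ] CyclotomicField (cycLevel 2 k r) ℚ)
    (c d a : ℤ) (A : ℕ)
    (z : ∀ (k : ℕ) (r : (cyclotomicLevelsRat 2 (badPlaces c d A N)).Ideals),
      H1 (tateRep W 2) ((cyclotomicLevelsRat 2 (badPlaces c d A N)).level k r.1))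
    (x : ∀ (k : ℕ) (r : (cyclotomicLevelsRat 2 (badPlaces c d A N)).Ideals),
      CyclotomicField (cycLevel 2 k r.1) ℚ),
    ZetaBody W 2 f ι κ' Λ' c d a A z x ∧ 2 * c.natAbs * d.natAbs * A * N ≠ 0 ∧
      ∀ n : ℕ, I.proj n y = levelToLayerTwo W hκ (badPlaces c d A N) n
        (z (n + 2) (cyclotomicLevelsRat 2 (badPlaces c d A N)).idealOne)

/-! ## Stub statements (named `Prop`s) -/

/-- **Z1 (port, size L; = `KolyvaginCharTwo.FlatDetectsKatoClassModTwo` sharpened from "some genuine class" to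
KATO'S OWN zeta lift).**  On the habitat⁺, FLAT in scalar form for the newform `f` of `W` implies: along every
cyclotomic `κ`, some Λ-adic lift of a Kato `(c,d,a(A))`-zeta family of `f` is NOT divisible by `2` in `𝐇¹_Γ(T₂W)`.
Mechanism: Otsuki's integral finite-layer Coleman maps over `ℚ₂` at `p = 2` send `z_N` to the Néron-normalised
`θ_N(W)` times the `(c,d)`/depletion factors (non-zero mod 2 in `Ω`); `y = 2w` would force `μ(θ_N) ≥ 1`, against
FLAT (`ThetaMuControlOfPollackPair`).  Otsuki 2009 Thm 3.6/4.1; Kurihara–Otsuki 2006 p. 564; Kato 2004 Ex. 13.3. -/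
def FlatDetectsKatoZetaClassModTwo : Prop :=
  ∀ (W : WeierstrassCurve ℚ) [W.IsElliptic] [W.IsGloballyMinimal], ¬ W.HasCM → W.analyticRank = 0 →
    GoodSS W 2 → W.frobeniusTrace 2 = 0 → W.Δ < 0 →
    ∀ [NeZero (W.conductorNorm ℤ)] (f : CuspForm (Gamma0 (W.conductorNorm ℤ)) 2), IsNewformOf W f →
    ∀ (ϖ : ℚ), (ϖ : ℝ) * W.realPeriodRat = plusPeriod f →
    ∀ (Lplus Lminus : IwasawaAlgebra 2), IsPollackPair f 2 Lplus Lminus →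
    padicValRat 2 ϖ + MuLambda.mu Lminus = 0 →
    ∀ [ContinuousSMul ℤ_[2] (W.tateModule 2)] [Module.Free ℤ_[2] (W.tateModule 2)]
      [Module.Finite ℤ_[2] (W.tateModule 2)]
      (κ : ZpExtension ℚ 2) (γ : Field.absoluteGaloisGroup ℚ) (hκ : κ.IsCyclotomic), κ.IsTopGenerator γ →
    ∀ (I : Kato2004.IwasawaH1Data W 2 κ γ),
      ∃ y : I.H, IsKatoZetaLift W hκ I f y ∧ ¬ ∃ w : I.H, y = (2 : IwasawaAlgebra 2) • w

/-- **ZD — THE LEVER (new; size XL as one statement, informally Z2 ∘ Z3 ∘ Z4 ∘ nonsquare-descent, see the module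
docstring): Kato's zeta class modulo 2 dominates the ρ̄-elliptic units.**  On the habitat⁺: if along every
cyclotomic `κ` some Kato zeta lift of the newform `f` of `W` is not divisible by `2`, then for `K ≅ ℚ(√Δ_W)` and
`F = K(W[2])·H(K)` the ρ̄-isotypic elliptic-unit index exponent `i_n(F) − i_n(H)` is bounded by a linear function of
`n` (equivalently, by Oukhaba: `μ` of the ρ̄-part of the 2-class-group tower of `F·ℚ_∞` vanishes).  Z2 = the
`𝕋_𝔪`-adic zeta element + Buzzard's mod-2 multiplicity one (Kim–Lee–Ponsinet arXiv:1909.01764 §4.3 ported to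
`p = 2`); Z3 = integral Kato–CM domination `y_{θ_ψ} ∈ Λ_𝒪·ζ_ψ^{tw}` (Kato 2004 §15 rationally; the 2-adic
integrality of the one comparison constant is the research content — failure mode: a negative 2-adic valuation of
the Betti-vs-CM period ratio of the partner); Z4 = `ψ̄_𝔓 = χ̄` ⇒ equal reductions of the two cyclotomic
specialisations of the 2-variable elliptic-unit system; then GNS ⇒ linear index bound (nonsquare-descent S1–S3). -/
def KatoZetaClassDominatesRhoUnitsAtTwo : Prop :=
  ∀ (W : WeierstrassCurve ℚ) [W.IsElliptic] [W.IsGloballyMinimal], ¬ W.HasCM → W.analyticRank = 0 →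
    GoodSS W 2 → W.frobeniusTrace 2 = 0 → W.Δ < 0 →
    ∀ [NeZero (W.conductorNorm ℤ)] (f : CuspForm (Gamma0 (W.conductorNorm ℤ)) 2), IsNewformOf W f →
    ∀ [ContinuousSMul ℤ_[2] (W.tateModule 2)] [Module.Free ℤ_[2] (W.tateModule 2)]
      [Module.Finite ℤ_[2] (W.tateModule 2)],
    (∀ (κ : ZpExtension ℚ 2) (γ : Field.absoluteGaloisGroup ℚ) (hκ : κ.IsCyclotomic), κ.IsTopGenerator γ →
        ∀ (I : Kato2004.IwasawaH1Data W 2 κ γ),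
          ∃ y : I.H, IsKatoZetaLift W hκ I f y ∧ ¬ ∃ w : I.H, y = (2 : IwasawaAlgebra 2) • w) →
    ∀ (K : Type) [Field K] [NumberField K], IsImaginaryQuadratic K →
      (∃ s : K, s ^ 2 = algebraMap ℚ K W.Δ) → ∀ (ι : K →+* ℂ),
        ∃ (l : ℕ) (ν : ℤ) (n₀ : ℕ), ∀ n, n₀ ≤ n →
          (IndexIdentityDescent.unitIndexTwoExp ι (IndexIdentityDescent.twoDivisionHilbertCompositum W K) n : ℤ)
            - IndexIdentityDescent.unitIndexTwoExp ι (rayClassField K (⊤ : Ideal (𝓞 K))) n ≤ l * n + ν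

/-- **PUB (published / classical inputs, bundled; each in print for all primes or trivial):** the analytic data
of `W` exist (modularity + Manin–Drinfeld + Pollack 2003 at `p = 2`; VERBATIM `KolyvaginCharTwo.AnalyticSupplyAtTwo`),
Oukhaba's index identity at 2 (Bull. SMF 135 (2007); VERBATIM `IndexIdentityDescent.OukhabaIndexAtTwo`), Lim 2017
Thm 3.5 at two (tree named fact; `IndexIdentityDescent.LimAtTwo`), `ℚ(W[2]) ≤ ℚ(W[4])` with 2-power index
(`IndexIdentityDescent.DivisionTowerTwoFour`). -/
def PublishedInputsAtTwo : Prop :=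
  KolyvaginCharTwo.AnalyticSupplyAtTwo ∧ IndexIdentityDescent.OukhabaIndexAtTwo ∧
    IndexIdentityDescent.LimAtTwo ∧ IndexIdentityDescent.DivisionTowerTwoFour

/-! ## The stubs (the ONLY `sorry`s of this file) -/

/-- Z1 · FLAT detects Kato's zeta lift mod 2 (port, L). -/
theorem stub_flatDetectsKatoZetaClassModTwo : FlatDetectsKatoZetaClassModTwo := by
  sorry

/-- ZD · THE LEVER: zeta-congruence transport mod 2 to the ρ̄-elliptic units (XL; Z2 port L, Z3 research, Z4 M). -/
theorem stub_katoZetaDominatesRhoUnitsAtTwo : KatoZetaClassDominatesRhoUnitsAtTwo := by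
  sorry

/-- FLAT · the SIBLING CRUX 21437 by name (not this line's content). -/
theorem stub_flatAtTwo : SignedMuAnalyticAtTwoPlus := by
  sorry

/-- T2+T5 · the index identity twice + descent to `ℚ(W[2])` (classical, M; VERBATIM `index_identity_descent`). -/
theorem stub_fineHalfOfRhoUnitIndexBounded : IndexIdentityDescent.FineHalfOfRhoUnitIndexBounded := by
  sorry

/-- (P⁺) · the plus-local half on the habitat⁺ (shared with every sibling line, L). -/
theorem stub_plusHalfOnHabitat : IndexIdentityDescent.PlusHalfOnHabitat := by
  sorry

/-- PUB · published inputs bundle (S each as named facts). -/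
theorem stub_publishedInputsAtTwo : PublishedInputsAtTwo := by
  sorry

/-! ## In-Lean sanity checks of the mod-2 scalar bookkeeping used by Z2/Z4 (Euler and `(c,d)` factors are
non-zero in `𝔽₂[T]`, hence act injectively on the torsion-free `H¹(ρ̄ ⊗ Ω)`): the depleting Euler factor at a good
`ℓ` reduces to `1 + ā·u + u²` with `u = (1+T)^e` a unit; for `ā = 0` its constant term vanishes but the polynomial
does not; the `(c,d)`-factor reduces to `1 - u` which is non-zero as soon as `e ≠ 0`. -/

example : (1 + (1 + Polynomial.X) ^ 2 : Polynomial (ZMod 2)) ≠ 0 := by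
  intro h
  have := congrArg (Polynomial.eval 1) h
  simp at this
  exact absurd this (by decide)

example : (1 - (1 + Polynomial.X) ^ 2 : Polynomial (ZMod 2)) ≠ 0 := by
  intro h
  have := congrArg (Polynomial.eval 1) h
  simp at this

/-! ## Glue (sorry-free given the stubs) -/

/-- The unit-side statement of `index_identity_descent` (its research stub T6⟹T4) FROM FLAT: analytic data (PUB),
FLAT in scalar form (sibling crux via `signedMuAnalyticAtTwoPlus_iff_padicValRat_add_mu_eq_zero`), Z1, ZD. -/
theorem rhoUnitIndexBoundedOnHabitat_of_flat (hA : KolyvaginCharTwo.AnalyticSupplyAtTwo)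
    (hflat : SignedMuAnalyticAtTwoPlus) (z1 : FlatDetectsKatoZetaClassModTwo)
    (zd : KatoZetaClassDominatesRhoUnitsAtTwo) : IndexIdentityDescent.RhoUnitIndexBoundedOnHabitat := by
  intro W _ _ hCM hr hss ha hΔ K _ _ hK hs ι
  obtain ⟨hN, f, ϖ, Lplus, Lminus, hf, hϖ, hP⟩ := hA W hss ha
  have hfl : padicValRat 2 ϖ + MuLambda.mu Lminus = 0 :=
    (Theorems.SignedMuAtTwo.signedMuAnalyticAtTwoPlus_iff_padicValRat_add_mu_eq_zero.mp hflat)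
      W hCM hr hss ha hΔ f hf ϖ hϖ Lplus Lminus hP
  haveI : ContinuousSMul ℤ_[2] (W.tateModule 2) := TateModule.continuousSMul_padicInt
  haveI : Module.Free ℤ_[2] (W.tateModule 2) := W.module_free_tateModule_holds 2
  haveI : Module.Finite ℤ_[2] (W.tateModule 2) := W.module_finite_tateModule_holds 2
  exact zd W hCM hr hss ha hΔ f hf
    (fun κ γ hκ hγ I ↦ z1 W hCM hr hss ha hΔ f hf ϖ hϖ Lplus Lminus hP hfl κ γ hκ hγ I) K hK hs ι

/-! ## The skeleton theorem (the ONLY theorem of this file concluding the crux) -/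

/-- **THE SKELETON THEOREM: the crux BY NAME; the only `sorry`s in its closure are the six `stub_*` theorems of
this file** (`A := W`, `e := AddEquiv.refl`; the `index_identity_descent` glue `sel2Seed_of_stubs` is sorry-free and
takes STATEMENTS as hypotheses; Sel2 door p580570). -/
theorem SignedMuSeedAtTwoPlus_of :
    Summit.BirchSwinnertonDyer.BirchSwinnertonDyer.Theses.ResidualThetaTransportAtTwo.SignedMuSeedAtTwoPlus := by
  refine Theorems.SignedMuAtTwo.signedMuSeedAtTwoPlus_of_sel2Seed ?_
  intro W _ _ hCM hr hss ha hΔ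
  obtain ⟨hA, t1, h5, h6⟩ := stub_publishedInputsAtTwo
  exact ⟨W, ‹_›, ‹_›, hss, ha, ⟨AddEquiv.refl _, fun σ P ↦ rfl⟩, fun κ γ hκ hγ _ ↦
    IndexIdentityDescent.sel2Seed_of_stubs t1
      (rhoUnitIndexBoundedOnHabitat_of_flat hA stub_flatAtTwo stub_flatDetectsKatoZetaClassModTwo
        stub_katoZetaDominatesRhoUnitsAtTwo)
      stub_fineHalfOfRhoUnitIndexBounded stub_plusHalfOnHabitat h5 h6 W hCM hr hss ha hΔ κ γ hκ hγ⟩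

end Summit.BirchSwinnertonDyer.BirchSwinnertonDyer.Cruxes.SignedMuSeedAtTwoPlus.ZetaCongruence

end
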